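import Literature.IUT.HodgeTheaters.ProfiniteCompletionLifting
import HarnessLib

/-!
# [IUTchI] §2 plumbing, V: extending homomorphisms from `η⁻¹(U)` to an open subgroup `U ⊆ Ĝ`

Mochizuki, *Inter-universal Teichmüller theory I*, kurims manuscript (May 2020), §2, Lemma 2.7 (v),
proof p. 59 [cite: Mochizuki2012, Lem 2.7(v) p.59] (D-0012 claim key, status disputed — plain profinite
group theory, no side taken).  Part IV (`ProfiniteCompletionLifting.lean`, abc-iut-L5-t17) proved the
lifting lemma for open subgroups `U` of the profinite completion `Ĝ` of a FREE group in one block: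
(1) lift on the discrete subgroup `H = η⁻¹(U)` using freeness, (2) extend from `H` to `U` through the
components at a deep enough level.  Step (2) holds for ANY discrete group `G` and any homomorphism
`θ₀ : H → B` to a finite group; this file exports it stand-alone, because the orientable-surface-group
half of Lemma 2.7 (v) (where step (1) is replaced by a lift built from a surface-group presentation)
needs exactly this:

* `mem_comap_of_val_eq` — if `U` contains the principal congruence subgroup of level `N₁`, `x ∈ U` and
  `x ≡ η(t) (mod N)` for some `N ≤ N₁`, then `t ∈ η⁻¹(U)`;
* `exists_extension` — for `U ⊇ {x | x.val N₀ = 1}` and `θ₀ : η⁻¹(U) → B`, `B` finite, there are a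
  homomorphism `θ : U → B` and a level `N ≤ N₀` with `θ(x) = θ₀(t)` whenever `x ≡ η(t) (mod N)`
  (so `θ ∘ η = θ₀`, and `θ` kills the principal congruence subgroup of level `N`, i.e. is continuous);
* `exists_extension_lift` — the form used in embedding problems: if `α ∘ θ₀ = ψ ∘ η` on `η⁻¹(U)` for a
  `ψ : U → B̄` killing a principal congruence subgroup, then `α ∘ θ = ψ` for some `θ : U → B`.

Theorems only.
-/

namespace Literature.IUT.HodgeTheaters.ProfiniteCompletion

open CategoryTheory ProfiniteGrp ProfiniteGrp.ProfiniteCompletion Topology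

universe u

variable {G : Type u} [Group G]

/-- If `U ⊆ Ĝ` contains the principal congruence subgroup of level `N₁`, `x ∈ U`, and the `N`-component
of `x` is the class of `t ∈ G` for some `N ≤ N₁`, then `η(t) ∈ U`, i.e. `t ∈ η⁻¹(U)`: indeed
`x⁻¹ η(t)` has trivial `N`-component. [cite: Mochizuki2012, Lem 2.7(v) p.59] -/
theorem mem_comap_of_val_eq {U : Subgroup (profiniteCompletion G)} {N₁ N : FiniteIndexNormalSubgroup G}
    (hN₁ : ∀ x : profiniteCompletion G, x.val N₁ = 1 → x ∈ U) (hle : N ≤ N₁)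
    {x : profiniteCompletion G} (hx : x ∈ U) {t : G}
    (ht : x.val N = (QuotientGroup.mk t : G ⧸ N.toSubgroup)) :
    t ∈ U.comap (toCompletion G) := by
  have e : (x⁻¹ * toCompletion G t).val N = 1 := by
    have e' : (x⁻¹ * toCompletion G t).val N = (x.val N)⁻¹ * (toCompletion G t).val N := rfl
    rw [e', ht]
    exact inv_mul_cancel _
  have hy : x⁻¹ * toCompletion G t ∈ U := hN₁ _ (val_eq_one_of_le _ hle e)
  have := U.mul_mem hx hy
  rw [mul_inv_cancel_left] at this
  exact this

/-- **Extension from `η⁻¹(U)` to `U`.**  Let `U ⊆ Ĝ` contain the principal congruence subgroup of level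
`N₀`, and let `θ₀ : η⁻¹(U) → B` be a homomorphism to a FINITE group.  Then there are a homomorphism
`θ : U → B` and a level `N ≤ N₀` such that `θ(x) = θ₀(t)` whenever `x ∈ U` and `x ≡ η(t) (mod N)` with
`t ∈ η⁻¹(U)`.  (Take `N = core(Ker θ₀) ⊓ N₀` and define `θ` through any representative of the
`N`-component; step (2) of the lifting lemma of part IV.) [cite: Mochizuki2012, Lem 2.7(v) p.59] -/
theorem exists_extension {U : Subgroup (profiniteCompletion G)} (N₀ : FiniteIndexNormalSubgroup G)
    (hN₀ : ∀ x : profiniteCompletion G, x.val N₀ = 1 → x ∈ U)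
    {B : Type*} [Group B] [Finite B] (θ₀ : U.comap (toCompletion G) →* B) :
    ∃ (θ : U →* B) (N : FiniteIndexNormalSubgroup G), N ≤ N₀ ∧
      ∀ (x : profiniteCompletion G) (hx : x ∈ U) (t : G) (ht : t ∈ U.comap (toCompletion G)),
        x.val N = (QuotientGroup.mk t : G ⧸ N.toSubgroup) → θ ⟨x, hx⟩ = θ₀ ⟨t, ht⟩ := by
  classical
  let H : Subgroup G := U.comap (toCompletion G)
  -- `H` has finite index (it contains `N₀`), hence so does `Ker θ₀` viewed in `G`
  haveI hHfi : H.FiniteIndex := by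
    apply Subgroup.finiteIndex_of_le (H := N₀.toSubgroup)
    intro g hg
    change toCompletion G g ∈ U
    apply hN₀
    change (QuotientGroup.mk g : G ⧸ N₀.toSubgroup) = 1
    rw [QuotientGroup.eq_one_iff]
    exact hg
  let K : Subgroup G := θ₀.ker.map H.subtype
  haveI hKfi : K.FiniteIndex := by
    constructor
    rw [Subgroup.index_map_subtype]
    refine mul_ne_zero ?_ hHfi.index_ne_zero
    rw [Subgroup.index_ker]
    exact Nat.card_pos.ne'
  let M₀ : FiniteIndexNormalSubgroup G := FiniteIndexNormalSubgroup.ofSubgroup K.normalCore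
  let N : FiniteIndexNormalSubgroup G := M₀ ⊓ N₀
  -- representatives of the `N`-components
  have hrep0 : ∀ x : profiniteCompletion G, ∃ g : G,
      x.val N = (QuotientGroup.mk g : G ⧸ N.toSubgroup) := fun x => by
    obtain ⟨g, hg⟩ := QuotientGroup.mk_surjective (x.val N)
    exact ⟨g, hg.symm⟩
  choose rep hrep using hrep0
  have key1 : ∀ (x : profiniteCompletion G), x ∈ U → rep x ∈ H := fun x hx =>
    mem_comap_of_val_eq hN₀ inf_le_right hx (hrep x)
  -- `θ₀` is constant on `N`-cosets
  have key3 : ∀ g g' : H, ((g : G)⁻¹ * g' ∈ N.toSubgroup) → θ₀ g = θ₀ g' := by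
    intro g g' hgg'
    have hK : (g : G)⁻¹ * g' ∈ K := K.normalCore_le ((inf_le_left : N ≤ M₀) hgg')
    obtain ⟨k, hk, hkg⟩ := Subgroup.mem_map.mp hK
    have hk' : k = g⁻¹ * g' := Subtype.ext (by simpa using hkg)
    rw [hk', MonoidHom.mem_ker, map_mul, map_inv, inv_mul_eq_one] at hk
    exact hk
  -- the extension
  let θf : U → B := fun x => θ₀ ⟨rep x.1, key1 x.1 x.2⟩
  have θmul : ∀ x y : U, θf (x * y) = θf x * θf y := by
    intro x y
    change θ₀ _ = θ₀ _ * θ₀ _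
    rw [← map_mul]
    apply key3
    change (rep (x.1 * y.1))⁻¹ * (rep x.1 * rep y.1) ∈ N.toSubgroup
    rw [← QuotientGroup.eq, QuotientGroup.mk_mul, ← hrep x.1, ← hrep y.1, ← hrep (x.1 * y.1)]
    rfl
  refine ⟨MonoidHom.mk' θf θmul, N, inf_le_right, fun x hx t ht hxt => ?_⟩
  change θ₀ ⟨rep x, key1 x hx⟩ = θ₀ ⟨t, ht⟩
  apply key3
  change (rep x)⁻¹ * t ∈ N.toSubgroup
  rw [← QuotientGroup.eq, ← hrep x, hxt]

/-- **Extension of a lift.**  Let `U ⊆ Ĝ` contain a principal congruence subgroup, `ψ : U → B̄` a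
homomorphism killing a principal congruence subgroup, `α : B → B̄` a homomorphism from a finite group,
and `θ₀ : η⁻¹(U) → B` a lift of `ψ ∘ η` (`α ∘ θ₀ = ψ ∘ η`).  Then `ψ` itself lifts: `α ∘ θ = ψ` for some
`θ : U → B`.  (The free-group lifting lemma of part IV is this with `θ₀` supplied by Nielsen–Schreier;
the surface-group case supplies `θ₀` from a presentation.) [cite: Mochizuki2012, Lem 2.7(v) p.59] -/
theorem exists_extension_lift (U : Subgroup (profiniteCompletion G))
    (hU : ∃ N₁ : FiniteIndexNormalSubgroup G, ∀ x : profiniteCompletion G, x.val N₁ = 1 → x ∈ U)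
    {B Bbar : Type*} [Group B] [Group Bbar] [Finite B]
    (α : B →* Bbar) (ψ : U →* Bbar)
    (hψ : ∃ N₂ : FiniteIndexNormalSubgroup G,
      ∀ (x : profiniteCompletion G) (hx : x ∈ U), x.val N₂ = 1 → ψ ⟨x, hx⟩ = 1)
    (θ₀ : U.comap (toCompletion G) →* B)
    (hθ₀ : ∀ t : U.comap (toCompletion G), α (θ₀ t) = ψ ⟨toCompletion G t, t.2⟩) :
    ∃ θ : U →* B, ∀ x : U, α (θ x) = ψ x := by
  obtain ⟨N₁, hN₁⟩ := hU
  obtain ⟨N₂, hN₂⟩ := hψ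
  have hN₀ : ∀ x : profiniteCompletion G, x.val (N₁ ⊓ N₂) = 1 → x ∈ U := fun x hx =>
    hN₁ x (val_eq_one_of_le x inf_le_left hx)
  obtain ⟨θ, N, hNle, hθ⟩ := exists_extension (N₁ ⊓ N₂) hN₀ θ₀
  refine ⟨θ, fun x => ?_⟩
  obtain ⟨t, hxt⟩ := QuotientGroup.mk_surjective (x.1.val N)
  have ht : t ∈ U.comap (toCompletion G) :=
    mem_comap_of_val_eq hN₁ (hNle.trans inf_le_left) x.2 hxt.symm
  have h1 : θ x = θ₀ ⟨t, ht⟩ := hθ x.1 x.2 t ht hxt.symm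
  -- `ψ x = ψ (η t)`: the quotient `x⁻¹ η(t)` is killed by `ψ`
  have e : (x.1⁻¹ * toCompletion G t).val N = 1 := by
    have e' : (x.1⁻¹ * toCompletion G t).val N = (x.1.val N)⁻¹ * (toCompletion G t).val N := rfl
    rw [e', ← hxt]
    exact inv_mul_cancel _
  have hy : x.1⁻¹ * toCompletion G t ∈ U := hN₁ _ (val_eq_one_of_le _ (hNle.trans inf_le_left) e)
  have hψy : ψ ⟨x.1⁻¹ * toCompletion G t, hy⟩ = 1 :=
    hN₂ _ hy (val_eq_one_of_le _ (hNle.trans inf_le_right) e)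
  have hprod : x * ⟨x.1⁻¹ * toCompletion G t, hy⟩ = ⟨toCompletion G t, ht⟩ :=
    Subtype.ext (mul_inv_cancel_left x.1 (toCompletion G t))
  calc α (θ x) = ψ ⟨toCompletion G t, ht⟩ := by rw [h1, hθ₀]
    _ = ψ (x * ⟨x.1⁻¹ * toCompletion G t, hy⟩) := by rw [hprod]
    _ = ψ x := by rw [map_mul, hψy, mul_one]

end Literature.IUT.HodgeTheaters.ProfiniteCompletion
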